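import Literature.Probability.LatticeModels.AizenmanWickBound
import Literature.Probability.LatticeModels.CriticalGibbsUniqueness
import HarnessLib

/-!
# High-dimensional triviality of Ising scaling limits: discharges and the current trust base

Topic `Literature/Probability/LatticeModels`; family `crit-ising` (crit-ising.S13). Proof companion
of `HighDimTriviality` (the named fact
`isGaussianProcess_of_tendstoInDistribution_smearedSpin_printRegime`: every scaling limit in law of
the block-spin field of the nearest-neighbour Ising model on `ℤ^d`, `d ≥ 4`, in the printed
near-critical regime, is Gaussian — Aizenman–Duminil-Copin, Ann. of Math. 194 (2021), Thm 1.2 /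
Prop. 1.4 for `d = 4`; Panis 2023, Thm 5.5 for `d ≥ 5`) and of `HighDimTrivialityMoments`.

## Contents (theorems only; no definitions, no named facts)

* `oddSpinCorrelation_eq_zero_holds` — **discharge** of the named fact `oddSpinCorrelation_eq_zero`
  of `HighDimTrivialityMoments` (flip symmetry of the unique zero-field state up to and including
  `β_c`, `d ≥ 3`): its reduction `oddSpinCorrelation_eq_zero_of_facts` fed with the tree's
  theorems `hasUniqueGibbsMeasure_of_lt_criticalBeta_holds`, `hasUniqueGibbsMeasure_criticalBeta_holds`
  (`CriticalGibbsUniqueness`), `exists_freeMeasure_holds` (`FreeStateGibbs`) and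
  `isingCorr_free_of_odd_card_holds` (`PlusFreeComparison`).
* `normalizedField_variance_bounds_holds` — **discharge** of the named fact
  `normalizedField_variance_bounds` of `HighDimTriviality` (ADC 2021, p. 6, display after
  Prop. 1.4; Panis 2023, §1.2.1 fn. 3): its reduction `normalizedField_variance_bounds_of_facts`
  (`HighDimTrivialityMoments`, Part G) fed with the same theorems.
* `panis_mgf_normalizedField_bound_of_wickDeviation` — Panis 2023, Thm 5.5 for the
  nearest-neighbour model, `d ≥ 5` (`panis_mgf_normalizedField_bound` of `HighDimTriviality`),
  from the SOURCE form of Aizenman's Prop. 12.1 in finite volume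
  (`aizenman_wickDeviation_le_finite`, `AizenmanWickBound`) and the `d ≥ 5` bound on `∑ |U₄|`
  (`panis_ursellFourSum_le`); the corrected counterpart of `panis_mgf_normalizedField_bound_of_finite`
  (`HighDimTrivialityWick`), whose random-current input `aizenman_pairingSum_sub_nPoint_le_finite`
  (the form quoted in ADC 2021, §6.3) is refuted in `AizenmanWickBoundLocal`.
* `isGaussianProcess_of_tendstoInDistribution_smearedSpin_printRegime_of_wickDeviation` — the
  capstone with the **current trust base**: crit-ising.S13 (printed regime) follows from exactly
  three named facts without proof, each a printed theorem —
  `aizenman_wickDeviation_le_finite` (Aizenman 1982, Prop. 12.1, finite graphs),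
  `aizenmanDuminilCopin_ursellFourSum_le` (ADC 2021, Thm 1.3 with §6.3, `d = 4`) and
  `panis_ursellFourSum_le` (Panis 2023, Thm 5.5, `d ≥ 5`); everything else (Newman's Gaussian
  inequality, the tree diagram bound, flip symmetry, the variance bounds, uniqueness below and at
  `β_c`, the free state, box limits, the infrared bound and the probabilistic assembly) is a theorem
  of the tree. The discharge `…_printRegime_holds` is this theorem applied to the three `_holds`
  once they land.

## References

* M. Aizenman, H. Duminil-Copin, Ann. of Math. 194 (2021) 163–235 = arXiv:1912.07973, Thm 1.2,
  Thm 1.3, Prop. 1.4 (p. 6) and §6.3 (p. 26) [AizenmanDuminilCopinAnnals2021] (held; read pp. 4–6, 26).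
* R. Panis, arXiv:2309.05797 = Ann. Probab. 54 (2026), Thm 5.5 and its proof (pp. 21–22)
  [Panis2023Triviality].
* M. Aizenman, Comm. Math. Phys. 86 (1982), Prop. 12.1 [AizenmanCMP1982] (through `AizenmanWickBound`).
-/

noncomputable section

open MeasureTheory ProbabilityTheory Filter
open Literature.Probability.LatticeModels Literature.Probability.Percolation

namespace Literature.Probability.LatticeModels

/-! ### Two discharges -/

/-- **Discharge of `oddSpinCorrelation_eq_zero`** ("by flip symmetry `⟨T_{f,L}^{2n+1}⟩_β = 0`",
Aizenman–Duminil-Copin 2021, §6.3, p. 26): for the nearest-neighbour ferromagnetic Ising model on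
`ℤ^d`, `d ≥ 3`, `0 ≤ β ≤ β_c` and every DLR state `μ ∈ 𝒢(β, 0)`, all odd correlations
`⟨σ_{x₁} ⋯ σ_{x_{2m+1}}⟩_μ` vanish. Proof: `𝒢(β, 0)` is a singleton (below `β_c`:
`hasUniqueGibbsMeasure_of_lt_criticalBeta_holds`; at `β_c`, `d ≥ 3`:
`hasUniqueGibbsMeasure_criticalBeta_holds`), its element is the free state
(`exists_freeMeasure_holds`), whose correlations are box limits of finite-volume free correlations,
odd ones vanishing by the spin flip (`isingCorr_free_of_odd_card_holds`) — assembled by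
`oddSpinCorrelation_eq_zero_of_facts`. [cite: AizenmanDuminilCopinAnnals2021, arXiv:1912.07973 §6.3 (p. 26), "by flip symmetry"] -/
theorem oddSpinCorrelation_eq_zero_holds : oddSpinCorrelation_eq_zero :=
  oddSpinCorrelation_eq_zero_of_facts
    (fun {_} {_} => hasUniqueGibbsMeasure_of_lt_criticalBeta_holds)
    (fun {_} => hasUniqueGibbsMeasure_criticalBeta_holds)
    (fun d {_} => exists_freeMeasure_holds d 0)
    (fun d => isingCorr_free_of_odd_card_holds (zdGraph d))

/-- **Discharge of `normalizedField_variance_bounds`** (Aizenman–Duminil-Copin 2021, p. 6, the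
display after Prop. 1.4: "`C r_f² ‖f‖²_∞ ≥ ⟨T_{f,L}²⟩_β ≥ c_f > 0` uniformly in `β ≤ β_c` and
`L`"; Panis 2023, §1.2.1, fn. 3): for `d ≥ 4` and `f ∈ C_0(ℝ^d)`, `⟨T_{f,L}²⟩_μ ≤ C_f` for all
`0 ≤ β ≤ β_c`, `L ≥ 1`, `μ ∈ 𝒢(β, 0)`, and `⟨T_{f,L}²⟩_μ ≥ c_f > 0` for `f ≥ 0`, `f ≢ 0`,
`L ≥ L₀(f)`. Proof: `normalizedField_variance_bounds_of_facts` (`HighDimTrivialityMoments`, Part G: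
the state is the translation-invariant free state with non-negative two-point function; Griffiths
monotonicity of second moments, a covering argument and Cauchy–Schwarz) fed with the tree's
uniqueness and free-state theorems. [cite: AizenmanDuminilCopinAnnals2021, arXiv:1912.07973 p. 6 (display after Prop. 1.4)] -/
theorem normalizedField_variance_bounds_holds : normalizedField_variance_bounds :=
  normalizedField_variance_bounds_of_facts
    (fun {_} {_} => hasUniqueGibbsMeasure_of_lt_criticalBeta_holds)
    (fun {_} => hasUniqueGibbsMeasure_criticalBeta_holds)
    (fun d {_} => exists_freeMeasure_holds d 0)

/-! ### Panis Thm 5.5 from the source form of Aizenman's inequality -/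

/-- **Panis 2023, Thm 5.5 (`d ≥ 5`, nearest-neighbour model) from Aizenman's Prop. 12.1 in finite
volume and the `d ≥ 5` bound on `∑ |U₄|`.** Granted `aizenman_wickDeviation_le_finite`
(Aizenman 1982, Prop. 12.1, the source form with the Wick functional `G_{2n-4}` of the remaining
points) and `panis_ursellFourSum_le` (`Σ_L⁻² ∑_{Λ_{rL}⁴} |U₄| ≤ C (β⁻⁴ ∨ β⁻²) r^γ L^{-(d-4)}`),
the exponential-moment estimate `panis_mgf_normalizedField_bound` holds with constant `24 C`: every
`μ ∈ 𝒢(β, 0)`, `0 < β ≤ β_c`, is the free state (uniqueness below and at `β_c`, theorems of the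
tree), which satisfies Newman's Gaussian inequality (`aizenman_nPoint_le_pairingSum_finite_holds`)
and, granted the fact, Prop. 12.1 (`pairingLowerBound_and_wickDeviationBound_of_freeCorr`); odd
moments vanish (`oddSpinCorrelation_eq_zero_holds`); the summation over `n` is
`abs_mgf_normalizedField_sub_exp_le_of_wickBounds` (Panis 2023, proof of Thm 5.5, pp. 21–22). [cite: Panis2023Triviality, proof of Thm. 5.5 (pp. 21–22)] -/
theorem panis_mgf_normalizedField_bound_of_wickDeviation
    (hW : aizenman_wickDeviation_le_finite) (hS : panis_ursellFourSum_le) :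
    panis_mgf_normalizedField_bound := by
  classical
  intro d hd
  obtain ⟨C, γ, hC, hγ, H⟩ := hS hd
  refine ⟨24 * C, γ, by positivity, hγ, fun β L r hβ hβc hL hr μ hμ f hf hfr z => ?_⟩
  haveI : IsProbabilityMeasure μ := hμ.1
  have hSle := H β L r hβ hβc hL hr μ hμ
  -- `μ` is the free state
  obtain ⟨μf, hμf, -, hcorr⟩ := exists_freeMeasure_holds d (β := β) 0 hβ.le le_rfl
  have huniq : HasUniqueGibbsMeasure (isingSpecification (zdGraph d) β 0) := by
    rcases hβc.lt_or_eq with hlt | heq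
    · exact hasUniqueGibbsMeasure_of_lt_criticalBeta_holds (by omega) hβ.le hlt
    · rw [heq]
      exact hasUniqueGibbsMeasure_criticalBeta_holds (by omega)
  have hμeq : μ = μf := huniq.1 hμ hμf
  subst hμeq
  obtain ⟨hlow, hWμ⟩ := pairingLowerBound_and_wickDeviationBound_of_freeCorr hW hβ.le hcorr
  -- odd correlations vanish (flip symmetry of the unique state)
  have hodd : ∀ {n : ℕ}, Odd n → ∀ x : Fin n → Site d, ∫ σ, ∏ i, spinAt (x i) σ ∂μ = 0 :=
    fun hn x => oddSpinCorrelation_eq_zero_holds (by omega) β hβ.le hβc μ hμ hn x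
  have key := abs_mgf_normalizedField_sub_exp_le_of_wickBounds hlow hWμ hodd
    (one_pos.trans_le hL) hf hfr z (r := r)
  refine key.trans (mul_le_mul_of_nonneg_left ?_ (Real.exp_pos _).le)
  have h0 : 0 ≤ (⨆ x, |f x|) ^ 4 := pow_nonneg (iSup_abs_nonneg f) 4
  have hz : 0 ≤ z ^ 4 := by positivity
  calc 24 * (⨆ x, |f x|) ^ 4 * ursellFourSum μ L r * z ^ 4
      ≤ 24 * (⨆ x, |f x|) ^ 4 *
          (C * max (β ^ (-4 : ℤ)) (β ^ (-2 : ℤ)) * r ^ γ / L ^ (d - 4)) * z ^ 4 := by gcongr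
    _ = 24 * C * max (β ^ (-4 : ℤ)) (β ^ (-2 : ℤ)) * (⨆ x, |f x|) ^ 4 * r ^ γ * z ^ 4 /
          L ^ (d - 4) := by ring

/-! ### crit-ising.S13 (printed regime) with the current trust base -/

universe u in
/-- **crit-ising.S13 in the printed regime from three printed theorems.** The Gaussianity of
scaling limits `isGaussianProcess_of_tendstoInDistribution_smearedSpin_printRegime`
(Aizenman–Duminil-Copin 2021, Thm 1.2 via Prop. 1.4 and p. 6, `d = 4`; Panis 2023, Thm 5.5 /
Thm 1.2, `d ≥ 5`) follows from (i) Aizenman 1982, Prop. 12.1 in finite volume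
(`aizenman_wickDeviation_le_finite`, random currents / random-walk representation), (ii) the
`d = 4` bound on `∑ |U₄|` in the critical window (`aizenmanDuminilCopin_ursellFourSum_le`: the
improved tree diagram bound, ADC Thm 1.3, with §6.3) and (iii) the `d ≥ 5` bound
(`panis_ursellFourSum_le`, Panis Thm 5.5), through
`aizenmanDuminilCopin_mgf_normalizedField_bound_abs_of_wickDeviation` (`AizenmanWickBound`),
`normalizedField_variance_bounds_holds`, `panis_mgf_normalizedField_bound_of_wickDeviation` and the
probabilistic assembly `…_printRegime_of_bounds'` (`HighDimTrivialityMoments`, Part E). All other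
inputs are theorems of the tree. [cite: AizenmanDuminilCopinAnnals2021, arXiv:1912.07973 Thm 1.2, Prop. 1.4 (p. 6) and §6.3 (p. 26)] -/
theorem isGaussianProcess_of_tendstoInDistribution_smearedSpin_printRegime_of_wickDeviation
    (hW : aizenman_wickDeviation_le_finite)
    (hS₄ : aizenmanDuminilCopin_ursellFourSum_le) (hS₅ : panis_ursellFourSum_le) :
    isGaussianProcess_of_tendstoInDistribution_smearedSpin_printRegime.{u} :=
  isGaussianProcess_of_tendstoInDistribution_smearedSpin_printRegime_of_bounds'
    (aizenmanDuminilCopin_mgf_normalizedField_bound_abs_of_wickDeviation hW hS₄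
      (fun {_} {_} => hasUniqueGibbsMeasure_of_lt_criticalBeta_holds)
      (fun {_} => hasUniqueGibbsMeasure_criticalBeta_holds))
    normalizedField_variance_bounds_holds
    (panis_mgf_normalizedField_bound_of_wickDeviation hW hS₅)

end Literature.Probability.LatticeModels

end
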